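import Mathlib.MeasureTheory.Integral.Average
import HarnessLib

/-!
# The sub-cell clustering factor of an inhomogeneous intensity (Chebyshev's order inequality)

Topic `Literature/MathematicalPhysics/KineticTheory`. Definition item
`defn-…HydrodynamicLimit.Theorems.KickFairRelEquilibriumNegative.SubcellClusteringBiasPersists`
(route `InformationPercolationEngine` of `AtomisticToContinuum/HydrodynamicLimit`, negative lemma
`KickFairRelEquilibrium_false_of_SubcellClusteringBiasPersists`).

WHAT IS (AND IS NOT) HERE. The Summit-side hypothesis `SubcellClusteringBiasPersists` is a
CONDITIONAL statement about collision statistics of the deterministic hard-sphere flow under a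
local Gibbs law (a lower bound on an `L¹` norm for infinitely many `N`); it is not a published
theorem and it is phrased over Summit-side objects, so it is NOT vendored into `Literature/`
(CONVENTIONS §2, §4). What the literature does supply, and this file formalises, is its STATIC
ingredient — the "clustering factor `1 + c₂`" of the negative lemma's docstring: for an ideal-gas
(Poisson / grand-canonical, activity-tilted) intensity `ρ ≥ 0` on a cell `Q`, pair-collision points
inside `Q` are distributed with density `∝ ρ²` (both partners at the same macroscopic point) while
third bodies have intensity `∝ ρ`; an observer who knows only the CELL (the coarse past) and
predicts third bodies from the cell count spread uniformly over `Q` (which is what the homogeneous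
law does on the fibre) under-estimates the intensity of third bodies at the collision point by the
ratio
`(⨍_Q ρ³) / ((⨍_Q ρ²) · (⨍_Q ρ))  =: subcellClusteringFactor μ ρ Q  = 1 + c₂`.
Chebyshev's order inequality for the similarly ordered pair `(ρ², ρ)` says this factor is `≥ 1`,
with equality iff `ρ` is a.e. constant on `Q`; the order-to-quadratic conversion gives the EXACT
excess `⨍ρ³ − ⨍ρ² ⨍ρ = ⨍ (ρ + m)(ρ − m)²`, `m = ⨍ρ` (`setAverage_pow_three_sub_mul_eq`), whence the
two-sided variance sandwich `(lo + m)·Var_Q ρ ≤ ⨍ρ³ − ⨍ρ²⨍ρ ≤ (hi + m)·Var_Q ρ` for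
`lo ≤ ρ ≤ hi` on `Q`. For a smooth activity on a cube of side `r` (`ρ = e^{α·(x − x_c)}(1 + O(r²))`,
`α = ∇ log ρ (x_c)`) both bounds are `2m · m²|α|²r²/12 · (1 + O(r))` and `⨍ρ²⨍ρ = m³(1 + O(r²))`,
i.e. `c₂ = r²|α|²/6 + O(r³)` — the constant quoted in the negative lemma (there obtained as
`sh(3t/2)/(3t/2) ÷ [sh t/t · sh(t/2)/(t/2)] = 1 + t²/6 + O(t⁴)` per axis, `t = α r`); the
asymptotics are not restated here, only the exact identity and the sandwich they follow from.

## Sources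

* J. M. Steele, *The Cauchy–Schwarz Master Class* (2004) [Steele2004], **Problem 5.2 (Chebyshev's
  order inequality), eqs. (5.8)–(5.9)** `E[f(X)] E[g(X)] ≤ E[f(X) g(X)]` for nondecreasing `f, g`,
  and the order-to-quadratic conversion (5.11) (read in the held copy, pp. 63–64 of the text).
  Here `f(y) = y²`, `g(y) = y` on `[0, ∞)`; the tree's general one-dimensional form is
  `Literature.Probability.Percolation.integral_mul_integral_le_integral_mul_of_monotone`
  (bounded monotone functions on a linearly ordered probability space); the cubic case is proved
  here directly, without boundedness, through the exact excess identity.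

## Contents

* `integral_pow_three_sub_mul_integral_eq` (exact excess),
  `integral_sq_mul_integral_le_integral_pow_three` (Chebyshev),
  `mul_variance_le_integral_pow_three_sub`, `integral_pow_three_sub_le_mul_variance` (sandwich) —
  probability-measure forms.
* `subcellClusteringFactor μ ρ Q`, `subcellClusteringExcess μ ρ Q` (`= factor − 1 = c₂`).
* `setAverage_pos_of_pos`, `setAverage_pow_three_sub_mul_eq`, `setAverage_sq_mul_setAverage_le`,
  `setAverage_pow_three_sub_mul_mem_Icc`, `one_le_subcellClusteringFactor`,
  `subcellClusteringExcess_nonneg`, `subcellClusteringExcess_eq_div`,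
  `subcellClusteringFactor_const`, `subcellClusteringExcess_const` — the cell-average forms.

Nothing about hard-sphere dynamics is asserted in this file.
-/

open MeasureTheory Set Filter
open scoped ENNReal

namespace Literature.MathematicalPhysics.KineticTheory

variable {X : Type*} [MeasurableSpace X]

/-! ### Probability form: Chebyshev's order inequality for `(ρ², ρ)` with its exact excess -/

section Probability

variable {P : Measure X} [IsProbabilityMeasure P] {ρ : X → ℝ}

/-- **Exact excess in Chebyshev's order inequality for the pair `(ρ², ρ)`** (order-to-quadratic
conversion): under a probability law, `E ρ³ − E ρ² · E ρ = E[(ρ + m)(ρ − m)²]` with `m = E ρ`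
(expand the right-hand side: `E ρ³ − m E ρ² − m² E ρ + m³ = E ρ³ − m E ρ²`).
[cite: Steele2004, Problem 5.2, (5.11)] -/
theorem integral_pow_three_sub_mul_integral_eq (h1 : Integrable ρ P)
    (h2 : Integrable (fun x => ρ x ^ 2) P) (h3 : Integrable (fun x => ρ x ^ 3) P) :
    ∫ x, ρ x ^ 3 ∂P - (∫ x, ρ x ^ 2 ∂P) * (∫ x, ρ x ∂P) =
      ∫ x, (ρ x + ∫ y, ρ y ∂P) * (ρ x - ∫ y, ρ y ∂P) ^ 2 ∂P := by
  set m : ℝ := ∫ y, ρ y ∂P with hm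
  have e : (fun x => (ρ x + m) * (ρ x - m) ^ 2) =
      fun x => (ρ x ^ 3 - m * ρ x ^ 2) - (m ^ 2 * ρ x - m ^ 3) := by
    funext x; ring
  have i12 : Integrable (fun x => ρ x ^ 3 - m * ρ x ^ 2) P := h3.sub (h2.const_mul m)
  have i3 : Integrable (fun x => m ^ 2 * ρ x - m ^ 3) P :=
    (h1.const_mul _).sub (integrable_const _)
  rw [e, integral_sub i12 i3, integral_sub h3 (h2.const_mul m),
    integral_sub (h1.const_mul _) (integrable_const _), integral_const_mul, integral_const_mul,
    integral_const]
  simp only [probReal_univ, one_smul]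
  ring

/-- The square of the deviation from the mean is integrable when `ρ, ρ²` are. [folklore] -/
theorem integrable_sub_integral_sq (h1 : Integrable ρ P) (h2 : Integrable (fun x => ρ x ^ 2) P) :
    Integrable (fun x => (ρ x - ∫ y, ρ y ∂P) ^ 2) P := by
  set m : ℝ := ∫ y, ρ y ∂P with hm
  have e : (fun x => (ρ x - m) ^ 2) = fun x => (ρ x ^ 2 - (2 * m) * ρ x) + m ^ 2 := by
    funext x; ring
  rw [e]
  exact (h2.sub (h1.const_mul _)).add (integrable_const _)

/-- The cubic excess integrand `(ρ + m)(ρ − m)²` is integrable when `ρ, ρ², ρ³` are. [folklore] -/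
theorem integrable_add_integral_mul_sub_integral_sq (h1 : Integrable ρ P)
    (h2 : Integrable (fun x => ρ x ^ 2) P) (h3 : Integrable (fun x => ρ x ^ 3) P) :
    Integrable (fun x => (ρ x + ∫ y, ρ y ∂P) * (ρ x - ∫ y, ρ y ∂P) ^ 2) P := by
  set m : ℝ := ∫ y, ρ y ∂P with hm
  have e : (fun x => (ρ x + m) * (ρ x - m) ^ 2) =
      fun x => (ρ x ^ 3 - m * ρ x ^ 2) - (m ^ 2 * ρ x - m ^ 3) := by
    funext x; ring
  rw [e]
  exact (h3.sub (h2.const_mul m)).sub ((h1.const_mul _).sub (integrable_const _))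

/-- **Chebyshev's order inequality for `(ρ², ρ)`, `ρ ≥ 0`:** `E ρ² · E ρ ≤ E ρ³` (the functions
`y ↦ y²` and `y ↦ y` are similarly ordered on `[0, ∞)`; here from the exact excess, whose
integrand `(ρ + m)(ρ − m)²` is nonnegative). [cite: Steele2004, Problem 5.2 (5.9)] -/
theorem integral_sq_mul_integral_le_integral_pow_three (h0 : 0 ≤ᵐ[P] ρ) (h1 : Integrable ρ P)
    (h2 : Integrable (fun x => ρ x ^ 2) P) (h3 : Integrable (fun x => ρ x ^ 3) P) :
    (∫ x, ρ x ^ 2 ∂P) * (∫ x, ρ x ∂P) ≤ ∫ x, ρ x ^ 3 ∂P := by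
  have hm : 0 ≤ ∫ y, ρ y ∂P := integral_nonneg_of_ae h0
  have hid := integral_pow_three_sub_mul_integral_eq h1 h2 h3
  have hnn : 0 ≤ ∫ x, (ρ x + ∫ y, ρ y ∂P) * (ρ x - ∫ y, ρ y ∂P) ^ 2 ∂P :=
    integral_nonneg_of_ae (h0.mono fun x hx => mul_nonneg (add_nonneg hx hm) (sq_nonneg _))
  linarith

/-- **Variance sandwich, lower half:** if `lo ≤ ρ` a.s. then
`(lo + m) · E(ρ − m)² ≤ E ρ³ − E ρ² · E ρ`, `m = E ρ`. [folklore] -/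
theorem mul_variance_le_integral_pow_three_sub {lo : ℝ} (hlo : ∀ᵐ x ∂P, lo ≤ ρ x)
    (h1 : Integrable ρ P) (h2 : Integrable (fun x => ρ x ^ 2) P)
    (h3 : Integrable (fun x => ρ x ^ 3) P) :
    (lo + ∫ y, ρ y ∂P) * ∫ x, (ρ x - ∫ y, ρ y ∂P) ^ 2 ∂P ≤
      ∫ x, ρ x ^ 3 ∂P - (∫ x, ρ x ^ 2 ∂P) * (∫ x, ρ x ∂P) := by
  rw [integral_pow_three_sub_mul_integral_eq h1 h2 h3, ← integral_const_mul]
  refine integral_mono_ae ((integrable_sub_integral_sq h1 h2).const_mul _)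
    (integrable_add_integral_mul_sub_integral_sq h1 h2 h3) (hlo.mono fun x hx => ?_)
  exact mul_le_mul_of_nonneg_right (by linarith) (sq_nonneg _)

/-- **Variance sandwich, upper half:** if `ρ ≤ hi` a.s. then
`E ρ³ − E ρ² · E ρ ≤ (hi + m) · E(ρ − m)²`, `m = E ρ`. [folklore] -/
theorem integral_pow_three_sub_le_mul_variance {hi : ℝ} (hhi : ∀ᵐ x ∂P, ρ x ≤ hi)
    (h1 : Integrable ρ P) (h2 : Integrable (fun x => ρ x ^ 2) P)
    (h3 : Integrable (fun x => ρ x ^ 3) P) :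
    ∫ x, ρ x ^ 3 ∂P - (∫ x, ρ x ^ 2 ∂P) * (∫ x, ρ x ∂P) ≤
      (hi + ∫ y, ρ y ∂P) * ∫ x, (ρ x - ∫ y, ρ y ∂P) ^ 2 ∂P := by
  rw [integral_pow_three_sub_mul_integral_eq h1 h2 h3, ← integral_const_mul]
  refine integral_mono_ae (integrable_add_integral_mul_sub_integral_sq h1 h2 h3)
    ((integrable_sub_integral_sq h1 h2).const_mul _) (hhi.mono fun x hx => ?_)
  exact mul_le_mul_of_nonneg_right (by linarith) (sq_nonneg _)

end Probability

/-! ### The clustering factor of an intensity on a cell -/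

section Cell

variable (μ : Measure X)

/-- **The sub-cell clustering factor** of an intensity `ρ` on a cell `Q` (with respect to the
reference measure `μ`, Lebesgue in applications):
`subcellClusteringFactor μ ρ Q = (⨍_Q ρ³ dμ) / ((⨍_Q ρ² dμ) · (⨍_Q ρ dμ))`.
Interpretation (ideal gas / Poisson statistics with intensity `∝ ρ`): the mean intensity of third
bodies AT a pair-collision point of the cell (collision points have density `∝ ρ²`, so this is
`⨍ρ³/⨍ρ²`) divided by the intensity an observer of the cell COUNT alone assigns uniformly to the
cell (`∝ ⨍ρ`). Junk value `0` when the denominator vanishes (division by zero) or an average is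
undefined (`⨍` of a non-integrable function, or `μ Q = ∞`, is `0`). [folklore] -/
noncomputable def subcellClusteringFactor (ρ : X → ℝ) (Q : Set X) : ℝ :=
  (⨍ x in Q, ρ x ^ 3 ∂μ) / ((⨍ x in Q, ρ x ^ 2 ∂μ) * ⨍ x in Q, ρ x ∂μ)

/-- **The sub-cell clustering excess** `c₂ = subcellClusteringFactor − 1` (the relative
enhancement of third bodies at collision points that the coarse observer misses). [folklore] -/
noncomputable def subcellClusteringExcess (ρ : X → ℝ) (Q : Set X) : ℝ :=
  subcellClusteringFactor μ ρ Q - 1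

variable {μ} {ρ : X → ℝ} {Q : Set X}

/-- Unfolding lemma for the clustering factor. [folklore] -/
theorem subcellClusteringFactor_def (μ : Measure X) (ρ : X → ℝ) (Q : Set X) :
    subcellClusteringFactor μ ρ Q =
      (⨍ x in Q, ρ x ^ 3 ∂μ) / ((⨍ x in Q, ρ x ^ 2 ∂μ) * ⨍ x in Q, ρ x ∂μ) :=
  rfl

/-- Unfolding lemma for the clustering excess. [folklore] -/
theorem subcellClusteringExcess_def (μ : Measure X) (ρ : X → ℝ) (Q : Set X) :
    subcellClusteringExcess μ ρ Q = subcellClusteringFactor μ ρ Q - 1 :=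
  rfl

/-- The normalised restriction `(μ Q)⁻¹ μ|_Q` is a probability measure for `0 < μ Q < ∞`; cell
averages are integrals against it (`setAverage_eq'`). [folklore] -/
theorem isProbabilityMeasure_smul_restrict (hQ0 : μ Q ≠ 0) (hQ : μ Q ≠ ∞) :
    IsProbabilityMeasure ((μ.restrict Q univ)⁻¹ • μ.restrict Q) := by
  haveI : NeZero (μ Q) := ⟨hQ0⟩
  haveI : Fact (μ Q < ∞) := ⟨hQ.lt_top⟩
  exact isProbabilityMeasureSMul

/-- Integrability on the cell transfers to the normalised restriction. [folklore] -/
theorem integrable_smul_restrict_of_integrableOn (hQ0 : μ Q ≠ 0) {f : X → ℝ}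
    (hf : IntegrableOn f Q μ) : Integrable f ((μ.restrict Q univ)⁻¹ • μ.restrict Q) := by
  refine hf.smul_measure ?_
  rw [Measure.restrict_apply_univ]
  exact ENNReal.inv_ne_top.2 hQ0

/-- Almost-everywhere statements on the cell transfer to the normalised restriction. [folklore] -/
theorem ae_smul_restrict_of_ae_restrict (hQ : μ Q ≠ ∞) {p : X → Prop}
    (hp : ∀ᵐ x ∂μ.restrict Q, p x) : ∀ᵐ x ∂((μ.restrict Q univ)⁻¹ • μ.restrict Q), p x := by
  refine (Measure.ae_ennreal_smul_measure_iff ?_).2 hp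
  rw [Measure.restrict_apply_univ]
  exact ENNReal.inv_ne_zero.2 hQ

/-- **A cell average of an a.e. positive integrable function is positive** (`0 < μ Q < ∞`).
[folklore] -/
theorem setAverage_pos_of_pos (hQ0 : μ Q ≠ 0) (hQ : μ Q ≠ ∞) {f : X → ℝ}
    (hf : IntegrableOn f Q μ) (hpos : ∀ᵐ x ∂μ.restrict Q, 0 < f x) : 0 < ⨍ x in Q, f x ∂μ := by
  haveI := isProbabilityMeasure_smul_restrict hQ0 hQ
  rw [setAverage_eq']
  simp only [Measure.restrict_apply_univ] at *
  set P : Measure X := (μ Q)⁻¹ • μ.restrict Q with hP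
  have hfP : Integrable f P := by
    refine hf.smul_measure ?_
    exact ENNReal.inv_ne_top.2 hQ0
  have hposP : ∀ᵐ x ∂P, 0 < f x := (Measure.ae_ennreal_smul_measure_iff (ENNReal.inv_ne_zero.2 hQ)).2 hpos
  have h0P : 0 ≤ᵐ[P] f := hposP.mono fun x hx => hx.le
  rcases (integral_nonneg_of_ae h0P).lt_or_eq with h | h
  · exact h
  · exfalso
    have hae : f =ᵐ[P] 0 := (integral_eq_zero_iff_of_nonneg_ae h0P hfP).1 h.symm
    have hfalse : ∀ᵐ x ∂P, False := by
      filter_upwards [hae, hposP] with x hx hx'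
      rw [hx] at hx'
      exact lt_irrefl _ hx'
    have hP0 : P = 0 := ae_eq_bot.1 (eventually_false_iff_eq_bot.1 hfalse)
    exact (IsProbabilityMeasure.ne_zero P) hP0

/-- **Exact excess on a cell:** for `0 < μ Q < ∞` and `ρ, ρ², ρ³` integrable on `Q`,
`⨍_Q ρ³ − ⨍_Q ρ² · ⨍_Q ρ = ⨍_Q (ρ + m)(ρ − m)²` with `m = ⨍_Q ρ`.
[cite: Steele2004, Problem 5.2, (5.11)] -/
theorem setAverage_pow_three_sub_mul_eq (hQ0 : μ Q ≠ 0) (hQ : μ Q ≠ ∞)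
    (h1 : IntegrableOn ρ Q μ) (h2 : IntegrableOn (fun x => ρ x ^ 2) Q μ)
    (h3 : IntegrableOn (fun x => ρ x ^ 3) Q μ) :
    (⨍ x in Q, ρ x ^ 3 ∂μ) - (⨍ x in Q, ρ x ^ 2 ∂μ) * (⨍ x in Q, ρ x ∂μ) =
      ⨍ x in Q, (ρ x + ⨍ y in Q, ρ y ∂μ) * (ρ x - ⨍ y in Q, ρ y ∂μ) ^ 2 ∂μ := by
  haveI := isProbabilityMeasure_smul_restrict hQ0 hQ
  simp only [average_eq']
  exact integral_pow_three_sub_mul_integral_eq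
    (integrable_smul_restrict_of_integrableOn hQ0 h1)
    (integrable_smul_restrict_of_integrableOn hQ0 h2)
    (integrable_smul_restrict_of_integrableOn hQ0 h3)

/-- **Chebyshev on a cell:** for `0 < μ Q < ∞`, `ρ ≥ 0` a.e. on `Q` with `ρ, ρ², ρ³` integrable on
`Q`, `⨍_Q ρ² · ⨍_Q ρ ≤ ⨍_Q ρ³`. [cite: Steele2004, Problem 5.2 (5.9)] -/
theorem setAverage_sq_mul_setAverage_le (hQ0 : μ Q ≠ 0) (hQ : μ Q ≠ ∞)
    (h0 : ∀ᵐ x ∂μ.restrict Q, 0 ≤ ρ x) (h1 : IntegrableOn ρ Q μ)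
    (h2 : IntegrableOn (fun x => ρ x ^ 2) Q μ) (h3 : IntegrableOn (fun x => ρ x ^ 3) Q μ) :
    (⨍ x in Q, ρ x ^ 2 ∂μ) * (⨍ x in Q, ρ x ∂μ) ≤ ⨍ x in Q, ρ x ^ 3 ∂μ := by
  haveI := isProbabilityMeasure_smul_restrict hQ0 hQ
  simp only [average_eq']
  exact integral_sq_mul_integral_le_integral_pow_three (ae_smul_restrict_of_ae_restrict hQ h0)
    (integrable_smul_restrict_of_integrableOn hQ0 h1)
    (integrable_smul_restrict_of_integrableOn hQ0 h2)
    (integrable_smul_restrict_of_integrableOn hQ0 h3)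

/-- **Variance sandwich on a cell:** for `0 < μ Q < ∞`, `lo ≤ ρ ≤ hi` a.e. on `Q`, `ρ, ρ², ρ³`
integrable on `Q`, and `m = ⨍_Q ρ`, `V = ⨍_Q (ρ − m)²`:
`(lo + m) V ≤ ⨍_Q ρ³ − ⨍_Q ρ² · ⨍_Q ρ ≤ (hi + m) V`. (For `ρ = e^{α·(x−x_c)}` on a cube of side
`r`: both ends are `2m · m² |α|² r²/12 (1 + O(r))`, giving `c₂ = r²|α|²/6 + O(r³)`.) [folklore] -/
theorem setAverage_pow_three_sub_mul_mem_Icc (hQ0 : μ Q ≠ 0) (hQ : μ Q ≠ ∞) {lo hi : ℝ}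
    (hlo : ∀ᵐ x ∂μ.restrict Q, lo ≤ ρ x) (hhi : ∀ᵐ x ∂μ.restrict Q, ρ x ≤ hi)
    (h1 : IntegrableOn ρ Q μ) (h2 : IntegrableOn (fun x => ρ x ^ 2) Q μ)
    (h3 : IntegrableOn (fun x => ρ x ^ 3) Q μ) :
    (⨍ x in Q, ρ x ^ 3 ∂μ) - (⨍ x in Q, ρ x ^ 2 ∂μ) * (⨍ x in Q, ρ x ∂μ) ∈
      Icc ((lo + ⨍ y in Q, ρ y ∂μ) * ⨍ x in Q, (ρ x - ⨍ y in Q, ρ y ∂μ) ^ 2 ∂μ)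
        ((hi + ⨍ y in Q, ρ y ∂μ) * ⨍ x in Q, (ρ x - ⨍ y in Q, ρ y ∂μ) ^ 2 ∂μ) := by
  haveI := isProbabilityMeasure_smul_restrict hQ0 hQ
  simp only [average_eq', mem_Icc]
  exact ⟨mul_variance_le_integral_pow_three_sub (ae_smul_restrict_of_ae_restrict hQ hlo)
      (integrable_smul_restrict_of_integrableOn hQ0 h1)
      (integrable_smul_restrict_of_integrableOn hQ0 h2)
      (integrable_smul_restrict_of_integrableOn hQ0 h3),
    integral_pow_three_sub_le_mul_variance (ae_smul_restrict_of_ae_restrict hQ hhi)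
      (integrable_smul_restrict_of_integrableOn hQ0 h1)
      (integrable_smul_restrict_of_integrableOn hQ0 h2)
      (integrable_smul_restrict_of_integrableOn hQ0 h3)⟩

/-- **The clustering factor is at least `1`** for an a.e. positive intensity with `ρ, ρ², ρ³`
integrable on a cell of positive finite measure (Chebyshev). [cite: Steele2004, Problem 5.2 (5.9)] -/
theorem one_le_subcellClusteringFactor (hQ0 : μ Q ≠ 0) (hQ : μ Q ≠ ∞)
    (hpos : ∀ᵐ x ∂μ.restrict Q, 0 < ρ x) (h1 : IntegrableOn ρ Q μ)
    (h2 : IntegrableOn (fun x => ρ x ^ 2) Q μ) (h3 : IntegrableOn (fun x => ρ x ^ 3) Q μ) :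
    1 ≤ subcellClusteringFactor μ ρ Q := by
  have hd : 0 < (⨍ x in Q, ρ x ^ 2 ∂μ) * ⨍ x in Q, ρ x ∂μ :=
    mul_pos (setAverage_pos_of_pos hQ0 hQ h2 (hpos.mono fun x hx => by positivity))
      (setAverage_pos_of_pos hQ0 hQ h1 hpos)
  rw [subcellClusteringFactor, one_le_div hd]
  exact setAverage_sq_mul_setAverage_le hQ0 hQ (hpos.mono fun x hx => hx.le) h1 h2 h3

/-- **The clustering excess `c₂` is nonnegative** (same hypotheses). [cite: Steele2004, Problem 5.2 (5.9)] -/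
theorem subcellClusteringExcess_nonneg (hQ0 : μ Q ≠ 0) (hQ : μ Q ≠ ∞)
    (hpos : ∀ᵐ x ∂μ.restrict Q, 0 < ρ x) (h1 : IntegrableOn ρ Q μ)
    (h2 : IntegrableOn (fun x => ρ x ^ 2) Q μ) (h3 : IntegrableOn (fun x => ρ x ^ 3) Q μ) :
    0 ≤ subcellClusteringExcess μ ρ Q :=
  sub_nonneg.2 (one_le_subcellClusteringFactor hQ0 hQ hpos h1 h2 h3)

/-- **The excess in closed form:** `c₂ = ⨍_Q (ρ + m)(ρ − m)² / (⨍_Q ρ² · ⨍_Q ρ)` for an a.e.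
positive intensity (so the denominator is positive). [folklore] -/
theorem subcellClusteringExcess_eq_div (hQ0 : μ Q ≠ 0) (hQ : μ Q ≠ ∞)
    (hpos : ∀ᵐ x ∂μ.restrict Q, 0 < ρ x) (h1 : IntegrableOn ρ Q μ)
    (h2 : IntegrableOn (fun x => ρ x ^ 2) Q μ) (h3 : IntegrableOn (fun x => ρ x ^ 3) Q μ) :
    subcellClusteringExcess μ ρ Q =
      (⨍ x in Q, (ρ x + ⨍ y in Q, ρ y ∂μ) * (ρ x - ⨍ y in Q, ρ y ∂μ) ^ 2 ∂μ) /
        ((⨍ x in Q, ρ x ^ 2 ∂μ) * ⨍ x in Q, ρ x ∂μ) := by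
  have hd : 0 < (⨍ x in Q, ρ x ^ 2 ∂μ) * ⨍ x in Q, ρ x ∂μ :=
    mul_pos (setAverage_pos_of_pos hQ0 hQ h2 (hpos.mono fun x hx => by positivity))
      (setAverage_pos_of_pos hQ0 hQ h1 hpos)
  rw [subcellClusteringExcess, subcellClusteringFactor, ← setAverage_pow_three_sub_mul_eq hQ0 hQ
    h1 h2 h3, sub_div, div_self hd.ne']

/-- **A homogeneous intensity has clustering factor `1`** (no sub-cell structure to miss):
constant `ρ ≡ a ≠ 0` on a cell with `0 < μ Q < ∞`. [folklore] -/
theorem subcellClusteringFactor_const (hQ0 : μ Q ≠ 0) (hQ : μ Q ≠ ∞) {a : ℝ} (ha : a ≠ 0) :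
    subcellClusteringFactor μ (fun _ => a) Q = 1 := by
  simp only [subcellClusteringFactor, setAverage_const hQ0 hQ]
  rw [div_eq_one_iff_eq (by positivity)]
  ring

/-- Correspondingly the excess of a homogeneous intensity vanishes. [folklore] -/
theorem subcellClusteringExcess_const (hQ0 : μ Q ≠ 0) (hQ : μ Q ≠ ∞) {a : ℝ} (ha : a ≠ 0) :
    subcellClusteringExcess μ (fun _ => a) Q = 0 := by
  rw [subcellClusteringExcess, subcellClusteringFactor_const hQ0 hQ ha, sub_self]

end Cell

end Literature.MathematicalPhysics.KineticTheory
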